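import Summits.Ventures.YMGap.RobustBall.SummableMassGap
import Summits.Ventures.YMGap.RobustBall.BallClosure
import Summits.Ventures.YMGap.RobustBall.LocalSourceScreening
import Literature.Probability.LatticeModels.DobrushinMetricInfiniteRangeDefectStates
import HarnessLib

/-!
# Venture YMGap, track ROBUST-BALL (Y2) — TIER 2: local sources are screened AT THE WEIGHT RATE, uniformly on the
# weighted infinite-range ball (`MemBallZdS`)

HONEST FRAMING. WHAT THIS IS: a venture file (cell `pub-ymgap`, track Y2 ROBUST-BALL, seat rb-p1, theorems only): the
tier-2 twin of `LocalSourceScreening[Metric|Ball].lean`.  A member `W` of the weighted ball `MemBallZdS a Λ t` has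
INFINITE range (summable, `e^{t‖·‖_∞}`-weighted cross loads), so its one-site laws read every link and Föllmer's
comparison needs the summable-row form with defects — the tree's new
`DobrushinMetric.abs_integral_sub_integral_le_of_gibbs_pair_tsum` (Literature, rb-p1 g5) — with the WEIGHTED
super-solution `d(x) = B' e^{−t·dist(x,S)}/(1 − ρ)` (`Σ' C(x,y) e^{t‖x−y‖} ≤ ρ`):
* `oneLink_source_defect_S` — the one-link laws of `perturbedYMS W` and `perturbedYMS (W + V)` at `x` are within
  KR distance `(√N/2)·min(bV x, 4)` (Grüss + diameter cap), `bV x ≥ Σ'_{X ∋ x} osc_X(x)` the source's load at `x`;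
* ★ `abs_integral_sub_integral_le_of_source_S` — member `W` with the tier-2 loads (`a`, weighted `Λ_t` at weight
  `t ≥ 0`) inside the pair door `ρ := 6(d−1)|β| e^{a} e^{t} √(c v) + e^{a/2} √c Λ_t < 1`; source on the finite link
  set `S` (`bV ≤ B`, `= 0` off `S`, ANY strength): `|∫ f dμ − ∫ f dν| ≤ (√N/2·min(B,4))/(1 − ρ)·Σ_{y∈Δ} e^{−t·d(y,S)} δ_y`
  — SCREENING AT THE WEIGHT RATE `t` (RATE = WEIGHT, as in the tier-2 clustering rows);
* `su2_localScreeningS_dim4` — `SU(2)`, `ℤ⁴`, hypothesis-free: `6|β_W| e^{a} e^{t} + e^{a/2} √(2/3) Λ < 1 ⇒` on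
  `MemBallZdS a Λ t`: `(√2/2)·min(B,4)/(1−ρ)·e^{−t d(Λ_F,S)}·#Λ_F·K_F`.
WHAT THIS IS NOT: one-sided Dobrushin-comparison bounds; lattice strong coupling only, nothing about the continuum
limit or a Clay-sense mass gap.
-/

noncomputable section

open MeasureTheory Function Finset ProbabilityTheory Real
open scoped NNReal
open Literature.Probability.LatticeModels
open Literature.Probability.LatticeModels.DobrushinMetric
open Literature.MathematicalPhysics.QuantumLattice
open Literature.MathematicalPhysics.QuantumFieldTheory hiding ZdEdge
open Summit.Ventures.YMGap.RobustBall.StateStability (abs_tilt_sub_tilt_le_of_osc_sub)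
open Summit.QuantumFields.BalabanUV.InfraRed.StrongCouplingPoincareDoorSUN (oneLinkPoincareSUN_two_sharp)

namespace Summit.Ventures.YMGap.RobustBall

variable {d N : ℕ}

/-! ### The one-link source defect, tier 2 -/

/-- **The one-link SOURCE defect, tier 2.**  Member `W` and source `V`, both link-summable with continuous terms;
the one-link laws at `x` (same exterior `η`) of `perturbedYMS W` and `perturbedYMS (W + V)` are within
Kantorovich–Rubinstein distance `(√N/2)·min(bV x, 4)` on Frobenius-Lipschitz test functions, where
`bV x ≥ Σ'_{X ∋ x} osc_X(x)` is the one-link oscillation load of the source at `x`. -/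
theorem oneLink_source_defect_S (β : ℝ) {W V : Potential (ZdEdge d) (Matrix.specialUnitaryGroup (Fin N) ℂ)}
    {BW BV : Finset (ZdEdge d) → ℝ} (hW : IsLinkSummable W BW) (hWc : ∀ X, Continuous (W X))
    (hWdep : ∀ X, DependsOn (W X) (↑X : Set (ZdEdge d)))
    (hV : IsLinkSummable V BV) (hVc : ∀ X, Continuous (V X)) (hVdep : ∀ X, DependsOn (V X) (↑X : Set (ZdEdge d)))
    {oscV : Finset (ZdEdge d) → ZdEdge d → ℝ} (hoscV : ∀ X, Dobrushin.IsOscBound (V X) (oscV X))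
    (x : ZdEdge d) (hoscVs : Summable fun X : Finset (ZdEdge d) => (if x ∈ X then oscV X x else 0))
    {bV : ZdEdge d → ℝ} (hbV : ∑' X : Finset (ZdEdge d), (if x ∈ X then oscV X x else 0) ≤ bV x)
    (η : LGConfig d (Matrix.specialUnitaryGroup (Fin N) ℂ))
    (φ : Matrix.specialUnitaryGroup (Fin N) ℂ → ℝ) (L : ℝ) (hφm : Measurable φ) (hφb : ∃ M, ∀ s, |φ s| ≤ M)
    (hL : 0 ≤ L) (hφL : ∀ a b, |φ a - φ b| ≤ L * suFrobDist a b) :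
    |∫ s, φ s ∂(siteLaw (perturbedYMS (fundamentalRep (Fin N)) (N * β) W) x η) -
        ∫ s, φ s ∂(siteLaw (perturbedYMS (fundamentalRep (Fin N)) (N * β) (W + V)) x η)| ≤
      Real.sqrt N / 2 * min (bV x) 4 * L := by
  classical
  haveI : SecondCountableTopology (Matrix (Fin N) (Fin N) ℂ) :=
    inferInstanceAs (SecondCountableTopology (Fin N → Fin N → ℂ))
  haveI : SecondCountableTopology (Matrix.specialUnitaryGroup (Fin N) ℂ) :=
    Topology.IsEmbedding.subtypeVal.secondCountableTopology
  have hWV : IsLinkSummable (W + V) (BW + BV) := hW.add hV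
  have hWVc : ∀ X, Continuous ((W + V) X) := fun X => (hWc X).add (hVc X)
  have hWVdep : ∀ X, DependsOn ((W + V) X) (↑X : Set (ZdEdge d)) := fun X σ τ h => by
    simp only [Pi.add_apply, hWdep X h, hVdep X h]
  have hγ : IsSpecification (perturbedYMS (d := d) (fundamentalRep (Fin N)) (N * β) W) :=
    isSpecification_perturbedYMS _ (continuous_fundamentalRep (Fin N)) _ hW hWc hWdep
  have hγ' : IsSpecification (perturbedYMS (d := d) (fundamentalRep (Fin N)) (N * β) (W + V)) :=
    isSpecification_perturbedYMS _ (continuous_fundamentalRep (Fin N)) _ hWV hWVc hWVdep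
  have hP₁ := isProbabilityMeasure_siteLaw hγ x η
  have hP₂ := isProbabilityMeasure_siteLaw hγ' x η
  rw [siteLaw_perturbedYMS_thooft β hW hWc x η] at hP₁
  rw [siteLaw_perturbedYMS_thooft β hWV hWVc x η] at hP₂
  rw [siteLaw_perturbedYMS_thooft β hW hWc x η, siteLaw_perturbedYMS_thooft β hWV hWVc x η]
  set U₁ : Matrix.specialUnitaryGroup (Fin N) ℂ → ℝ := fun g =>
    ∑' X : Finset (ZdEdge d), (if x ∈ X then W X (Function.update η x g) else 0) with hU₁
  set U₂ : Matrix.specialUnitaryGroup (Fin N) ℂ → ℝ := fun g =>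
    ∑' X : Finset (ZdEdge d), (if x ∈ X then (W + V) X (Function.update η x g) else 0) with hU₂
  set UV : Matrix.specialUnitaryGroup (Fin N) ℂ → ℝ := fun g =>
    ∑' X : Finset (ZdEdge d), (if x ∈ X then V X (Function.update η x g) else 0) with hUV
  have hcont : ∀ {W' : Potential (ZdEdge d) (Matrix.specialUnitaryGroup (Fin N) ℂ)} {B' : Finset (ZdEdge d) → ℝ},
      IsLinkSummable W' B' → (∀ X, Continuous (W' X)) → Continuous fun g : Matrix.specialUnitaryGroup (Fin N) ℂ =>
        ∑' X : Finset (ZdEdge d), (if x ∈ X then W' X (Function.update η x g) else 0) :=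
    fun h hc => (continuous_tsum_through h hc x).comp (continuous_const.update x continuous_id)
  have hbdd : ∀ {W' : Potential (ZdEdge d) (Matrix.specialUnitaryGroup (Fin N) ℂ)} {B' : Finset (ZdEdge d) → ℝ},
      IsLinkSummable W' B' → ∃ C, ∀ g : Matrix.specialUnitaryGroup (Fin N) ℂ,
        |∑' X : Finset (ZdEdge d), (if x ∈ X then W' X (Function.update η x g) else 0)| ≤ C := by
    intro W' B' h
    refine ⟨∑' X : Finset (ZdEdge d), (if x ∈ X then B' X else 0), fun g => ?_⟩
    have hs := h.summable_through x (Function.update η x g)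
    rw [← Real.norm_eq_abs]
    refine (norm_tsum_le_tsum_norm hs.norm).trans (hs.norm.tsum_le_tsum (fun X => ?_) (h.summable x))
    rw [Real.norm_eq_abs]
    split_ifs
    · exact h.abs_le X _
    · simp
  have hU₁m : Measurable U₁ := (hcont hW hWc).measurable
  have hU₂m : Measurable U₂ := (hcont hWV hWVc).measurable
  have hU₁b : ∃ C, ∀ g, |U₁ g| ≤ C := hbdd hW
  have hU₂b : ∃ C, ∀ g, |U₂ g| ≤ C := hbdd hWV
  haveI := hP₁
  haveI := hP₂
  have hdiff : ∀ g, U₁ g - U₂ g = -UV g := fun g => by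
    have hsW := hW.summable_through x (Function.update η x g)
    have hsV := hV.summable_through x (Function.update η x g)
    have hsum : (∑' X : Finset (ZdEdge d), (if x ∈ X then (W + V) X (Function.update η x g) else 0)) =
        (∑' X : Finset (ZdEdge d), (if x ∈ X then W X (Function.update η x g) else 0)) +
          ∑' X : Finset (ZdEdge d), (if x ∈ X then V X (Function.update η x g) else 0) := by
      rw [← hsW.tsum_add hsV]
      exact tsum_congr fun X => by split_ifs <;> simp [Pi.add_apply]
    simp only [hU₁, hU₂, hUV]
    rw [hsum]
    ring
  have hoscUV : ∀ g g', UV g - UV g' ≤ bV x := fun g g' => by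
    have h := tsum_through_update_osc hV hoscV x hoscVs hbV η g g'
    simp only [hUV]; linarith
  have hoscD : ∀ a a', |(U₁ a - U₂ a) - (U₁ a' - U₂ a')| ≤ bV x := fun a a' => by
    rw [hdiff, hdiff, abs_le]
    constructor <;> linarith [hoscUV a a', hoscUV a' a]
  have hG := abs_tilt_sub_tilt_le_of_osc_sub (stapleField β x η) hU₁m hU₁b hU₂m hU₂b hoscD φ L hφm hφb hL hφL
  have hD := abs_integral_sub_integral_le_diam
    ((haarProbability (Matrix.specialUnitaryGroup (Fin N) ℂ)).tilted
      fun g => (N : ℝ) * ((g : Matrix (Fin N) (Fin N) ℂ) * stapleField β x η).trace.re - U₁ g)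
    ((haarProbability (Matrix.specialUnitaryGroup (Fin N) ℂ)).tilted
      fun g => (N : ℝ) * ((g : Matrix (Fin N) (Fin N) ℂ) * stapleField β x η).trace.re - U₂ g)
    φ L hφm hφb hφL hL
  rcases le_total (bV x) 4 with h4 | h4
  · rw [min_eq_left h4]
    simpa only [hU₁, hU₂] using hG.trans (le_of_eq (by ring))
  · rw [min_eq_right h4]
    calc _ ≤ 2 * Real.sqrt N * L := by simpa only [hU₁, hU₂] using hD
      _ = Real.sqrt N / 2 * 4 * L := by ring

/-! ### Screening at the weight rate: the tier-2 member -/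

/-- The weighted super-solution: with weighted rows `Σ' C(x,y) e^{t‖x−y‖} ≤ ρ < 1` and a defect `b ≤ B'` supported on
the finite link set `S`, `d(x) = B'/(1−ρ) · e^{−t·dist(x,S)}` satisfies `b x + Σ' C(x,y) d(y) ≤ d(x)`. -/
theorem superSolution_weighted {C : ZdEdge d → ZdEdge d → ℝ} (hC0 : ∀ x y, 0 ≤ C x y) {t ρ B' : ℝ} (ht : 0 ≤ t)
    (hρ1 : ρ < 1) (hB' : 0 ≤ B')
    (hCs : ∀ x, Summable fun y => C x y * exp (t * ‖x.1 - y.1‖))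
    (hroww : ∀ x, ∑' y, C x y * exp (t * ‖x.1 - y.1‖) ≤ ρ)
    {b : ZdEdge d → ℝ} (hbB : ∀ x, b x ≤ B') {S : Finset (ZdEdge d)} (hbS : ∀ x, x ∉ S → b x ≤ 0) (x : ZdEdge d) :
    b x + ∑' y, C x y * (B' / (1 - ρ) * exp (-t * linkSetDist S y)) ≤ B' / (1 - ρ) * exp (-t * linkSetDist S x) := by
  have h1ρ : 0 < 1 - ρ := sub_pos.2 hρ1
  have hK : 0 ≤ B' / (1 - ρ) := div_nonneg hB' h1ρ.le
  have hρ0 : 0 ≤ ρ := le_trans (tsum_nonneg fun y => mul_nonneg (hC0 x y) (exp_pos _).le) (hroww x)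
  have hcmp : ∀ y, exp (-t * linkSetDist S y) ≤ exp (-t * linkSetDist S x) * exp (t * ‖x.1 - y.1‖) := fun y => by
    rw [← exp_add]
    refine exp_le_exp.2 ?_
    have := linkSetDist_le_add_norm S x y
    nlinarith
  have hs : Summable fun y => C x y * (B' / (1 - ρ) * exp (-t * linkSetDist S y)) :=
    Summable.of_nonneg_of_le (fun y => mul_nonneg (hC0 x y) (by positivity))
      (fun y => by
        calc C x y * (B' / (1 - ρ) * exp (-t * linkSetDist S y))
            ≤ C x y * (B' / (1 - ρ) * (exp (-t * linkSetDist S x) * exp (t * ‖x.1 - y.1‖))) :=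
              mul_le_mul_of_nonneg_left (mul_le_mul_of_nonneg_left (hcmp y) hK) (hC0 x y)
          _ = B' / (1 - ρ) * exp (-t * linkSetDist S x) * (C x y * exp (t * ‖x.1 - y.1‖)) := by ring)
      (((hCs x).mul_left (B' / (1 - ρ) * exp (-t * linkSetDist S x))))
  have hsum : ∑' y, C x y * (B' / (1 - ρ) * exp (-t * linkSetDist S y)) ≤
      B' / (1 - ρ) * exp (-t * linkSetDist S x) * ρ := by
    calc ∑' y, C x y * (B' / (1 - ρ) * exp (-t * linkSetDist S y))
        ≤ ∑' y, B' / (1 - ρ) * exp (-t * linkSetDist S x) * (C x y * exp (t * ‖x.1 - y.1‖)) :=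
          hs.tsum_le_tsum (fun y => by
            calc C x y * (B' / (1 - ρ) * exp (-t * linkSetDist S y))
                ≤ C x y * (B' / (1 - ρ) * (exp (-t * linkSetDist S x) * exp (t * ‖x.1 - y.1‖))) :=
                  mul_le_mul_of_nonneg_left (mul_le_mul_of_nonneg_left (hcmp y) hK) (hC0 x y)
              _ = _ := by ring)
            ((hCs x).mul_left _)
      _ = B' / (1 - ρ) * exp (-t * linkSetDist S x) * ∑' y, C x y * exp (t * ‖x.1 - y.1‖) := tsum_mul_left
      _ ≤ B' / (1 - ρ) * exp (-t * linkSetDist S x) * ρ :=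
          mul_le_mul_of_nonneg_left (hroww x) (by positivity)
  have hbx : b x ≤ B' * exp (-t * linkSetDist S x) := by
    by_cases hx : x ∈ S
    · rw [linkSetDist_eq_zero_of_mem hx, mul_zero, exp_zero, mul_one]; exact hbB x
    · exact (hbS x hx).trans (by positivity)
  have hfix : B' * exp (-t * linkSetDist S x) + B' / (1 - ρ) * exp (-t * linkSetDist S x) * ρ =
      B' / (1 - ρ) * exp (-t * linkSetDist S x) := by
    field_simp
    ring
  linarith

section SUN

variable {W V : Potential (ZdEdge d) (Matrix.specialUnitaryGroup (Fin N) ℂ)} {BW BV : Finset (ZdEdge d) → ℝ}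

/-- ★ **TIER 2: LOCAL SOURCES ARE SCREENED AT THE WEIGHT RATE.**  Member `W` (continuous, link-summable, tier-2 loads:
oscillation `≤ a`, weighted diagonal-free cross load `≤ Λ_t` at weight `t ≥ 0`) inside the one-link pair door
`ρ := 6(d−1)|β| e^{a} e^{t} √(c v) + e^{a/2} √c Λ_t < 1`; source `V` (continuous, link-summable, ANY strength) whose
one-link oscillation loads `bV ≤ B` vanish off the finite link set `S`.  Then every DLR `μ` of `W` and EVERY DLR `ν` of
`W + V` satisfy, for every bounded local `f` on `Δ` with Frobenius-Lipschitz vector `δ`: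
`|∫ f dμ − ∫ f dν| ≤ (√N/2 · min(B,4))/(1 − ρ) · Σ_{y ∈ Δ} e^{−t·d(y,S)} · δ_y`. -/
theorem abs_integral_sub_integral_le_of_source_S (hd : 1 ≤ d) (hN : 1 ≤ N) {β b c v a Λt t : ℝ}
    (hc : 0 ≤ c) (hv : 0 ≤ v) (hb : |β| * (2 * ((d : ℝ) - 1)) ≤ b)
    (hP : ∀ B : Matrix (Fin N) (Fin N) ℂ, matrixOpNorm B ≤ b →
      ∀ (ψ : Matrix.specialUnitaryGroup (Fin N) ℂ → ℝ) (M : ℝ), 0 ≤ M →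
        (∀ x y, |ψ x - ψ y| ≤ M * suFrobDist x y) →
        Var[ψ; (haarProbability (Matrix.specialUnitaryGroup (Fin N) ℂ)).tilted
          fun g => (N : ℝ) * ((g : Matrix (Fin N) (Fin N) ℂ) * B).trace.re] ≤ c * M ^ 2)
    (hVB : ∀ B : Matrix (Fin N) (Fin N) ℂ, matrixOpNorm B ≤ b → ∀ Δ : Matrix (Fin N) (Fin N) ℂ,
      Var[fun g : Matrix.specialUnitaryGroup (Fin N) ℂ =>
          (N : ℝ) * ((g : Matrix (Fin N) (Fin N) ℂ) * Δ).trace.re;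
        (haarProbability (Matrix.specialUnitaryGroup (Fin N) ℂ)).tilted
          fun g => (N : ℝ) * ((g : Matrix (Fin N) (Fin N) ℂ) * B).trace.re] ≤ v * frobNorm Δ ^ 2)
    (h : IsLinkSummable W BW) (hWc : ∀ X, Continuous (W X))
    (hWdep : ∀ X, DependsOn (W X) (↑X : Set (ZdEdge d)))
    {osc : Finset (ZdEdge d) → ZdEdge d → ℝ} (hosc : ∀ X, Dobrushin.IsOscBound (W X) (osc X))
    (hoscs : ∀ e, Summable fun X : Finset (ZdEdge d) => (if e ∈ X then osc X e else 0))
    (hosca : ∀ e, ∑' X : Finset (ZdEdge d), (if e ∈ X then osc X e else 0) ≤ a)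
    {lip : Finset (ZdEdge d) → ZdEdge d → ℝ} (hlip : ∀ X, IsLipBound suFrobDist (W X) (lip X))
    {ℓ : ZdEdge d → ZdEdge d → ℝ}
    (hlips : ∀ e y, Summable fun X : Finset (ZdEdge d) => (if e ∈ X ∧ y ∈ X then lip X y else 0))
    (hℓ : ∀ e y, y ≠ e → ∑' X : Finset (ZdEdge d), (if e ∈ X ∧ y ∈ X then lip X y else 0) ≤ ℓ e y)
    (ht : 0 ≤ t) (hℓs : ∀ e, Summable fun y => (if y = e then 0 else ℓ e y) * exp (t * ‖e.1 - y.1‖))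
    (hℓt : ∀ e, ∑' y, (if y = e then 0 else ℓ e y) * exp (t * ‖e.1 - y.1‖) ≤ Λt)
    (hρ : 6 * ((d : ℝ) - 1) * |β| * (exp a * exp t * Real.sqrt (c * v)) + exp (a / 2) * Real.sqrt c * Λt < 1)
    (hV : IsLinkSummable V BV) (hVc : ∀ X, Continuous (V X)) (hVdep : ∀ X, DependsOn (V X) (↑X : Set (ZdEdge d)))
    {oscV : Finset (ZdEdge d) → ZdEdge d → ℝ} (hoscV : ∀ X, Dobrushin.IsOscBound (V X) (oscV X))
    (hoscVs : ∀ e, Summable fun X : Finset (ZdEdge d) => (if e ∈ X then oscV X e else 0))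
    {bV : ZdEdge d → ℝ} (hbV : ∀ e, ∑' X : Finset (ZdEdge d), (if e ∈ X then oscV X e else 0) ≤ bV e)
    {B : ℝ} (hB : ∀ e, bV e ≤ B) {S : Finset (ZdEdge d)} (hS : ∀ e, e ∉ S → bV e ≤ 0)
    {μ ν : Measure (LGConfig d (Matrix.specialUnitaryGroup (Fin N) ℂ))}
    (hμ : μ ∈ perturbedGibbsMeasuresS (d := d) (fundamentalRep (Fin N)) (N * β) W)
    (hν : ν ∈ perturbedGibbsMeasuresS (d := d) (fundamentalRep (Fin N)) (N * β) (W + V))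
    {f : LGConfig d (Matrix.specialUnitaryGroup (Fin N) ℂ) → ℝ} (hfm : Measurable f)
    {Δ : Finset (ZdEdge d)} (hfdep : DependsOn f (↑Δ : Set (ZdEdge d))) {M : ℝ} (hM : ∀ σ, |f σ| ≤ M)
    {δ : ZdEdge d → ℝ} (hδ : IsLipBound suFrobDist f δ) :
    |(∫ σ, f σ ∂μ) - ∫ σ, f σ ∂ν| ≤
      Real.sqrt N / 2 * min B 4 / (1 - (6 * ((d : ℝ) - 1) * |β| * (exp a * exp t * Real.sqrt (c * v)) +
        exp (a / 2) * Real.sqrt c * Λt)) * ∑ y ∈ Δ, exp (-t * linkSetDist S y) * δ y := by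
  classical
  haveI : SecondCountableTopology (Matrix (Fin N) (Fin N) ℂ) :=
    inferInstanceAs (SecondCountableTopology (Fin N → Fin N → ℂ))
  haveI : SecondCountableTopology (Matrix.specialUnitaryGroup (Fin N) ℂ) :=
    Topology.IsEmbedding.subtypeVal.secondCountableTopology
  set ρ : ℝ := 6 * ((d : ℝ) - 1) * |β| * (exp a * exp t * Real.sqrt (c * v)) + exp (a / 2) * Real.sqrt c * Λt with hρdef
  have hWV : IsLinkSummable (W + V) (BW + BV) := h.add hV
  have hWVc : ∀ X, Continuous ((W + V) X) := fun X => (hWc X).add (hVc X)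
  have hWVdep : ∀ X, DependsOn ((W + V) X) (↑X : Set (ZdEdge d)) := fun X σ τ hστ => by
    simp only [Pi.add_apply, hWdep X hστ, hVdep X hστ]
  have hγ : IsSpecification (perturbedYMS (d := d) (fundamentalRep (Fin N)) (N * β) W) :=
    isSpecification_perturbedYMS _ (continuous_fundamentalRep (Fin N)) _ h hWc hWdep
  have hγ' : IsSpecification (perturbedYMS (d := d) (fundamentalRep (Fin N)) (N * β) (W + V)) :=
    isSpecification_perturbedYMS _ (continuous_fundamentalRep (Fin N)) _ hWV hWVc hWVdep
  have hμ' : IsGibbsMeasure (perturbedYMS (d := d) (fundamentalRep (Fin N)) (N * β) W) μ := hμ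
  have hν' : IsGibbsMeasure (perturbedYMS (d := d) (fundamentalRep (Fin N)) (N * β) (W + V)) ν := hν
  have hℓ0 : ∀ x y, y ≠ x → 0 ≤ ℓ x y := fun x y hyx => by
    refine le_trans (tsum_nonneg fun X => ?_) (hℓ x y hyx)
    split_ifs
    · exact (hlip X).nonneg y
    · exact le_rfl
  have hrow := fun x => summable_coeffS_row₀ (β := β) (c := c) (v := v) (a := a) hd hℓ0 ht hℓs hℓt x
  have hℓs' : ∀ e, Summable fun y => (if y = e then 0 else ℓ e y) := fun e =>
    Summable.of_nonneg_of_le (fun y => by split_ifs with hye; exacts [le_rfl, hℓ0 e y hye])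
      (fun y => le_mul_of_one_le_right (by split_ifs with hye; exacts [le_rfl, hℓ0 e y hye])
        (one_le_exp (by positivity))) (hℓs e)
  set C : ZdEdge d → ZdEdge d → ℝ := fun x y => if y = x then 0 else
      (exp a * Real.sqrt (c * v) * |β| * linkInfluence x y + exp (a / 2) * Real.sqrt c * ℓ x y) with hCdef
  have hC0 : ∀ x y, 0 ≤ C x y := fun x y => by
    simp only [hCdef]
    split_ifs with hyx
    · exact le_rfl
    · exact add_nonneg (by positivity) (mul_nonneg (by positivity) (hℓ0 x y hyx))
  have hρ0 : 0 ≤ ρ := by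
    have hd0 : 0 < d := hd
    exact (tsum_nonneg (hC0 (0, ⟨0, hd0⟩))).trans (hrow (0, ⟨0, hd0⟩)).2.2.1
  have h1ρ : 0 < 1 - ρ := sub_pos.2 hρ
  have hbV0 : ∀ e, 0 ≤ bV e := fun e =>
    le_trans (tsum_nonneg fun X => by split_ifs; exacts [(hoscV X).nonneg e, le_rfl]) (hbV e)
  have hd0 : 0 < d := hd
  have hBmin : 0 ≤ min B 4 := le_min ((hbV0 (0, ⟨0, hd0⟩)).trans (hB _)) (by norm_num)
  set B' : ℝ := Real.sqrt N / 2 * min B 4 with hB'def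
  have hB'0 : 0 ≤ B' := by positivity
  set bdef : ZdEdge d → ℝ := fun x => Real.sqrt N / 2 * min (bV x) 4 with hbdef_def
  have hb0 : ∀ x, 0 ≤ bdef x := fun x => mul_nonneg (by positivity) (le_min (hbV0 x) (by norm_num))
  have hbB : ∀ x, bdef x ≤ B' := fun x => mul_le_mul_of_nonneg_left (min_le_min_right 4 (hB x)) (by positivity)
  have hbS : ∀ x, x ∉ S → bdef x ≤ 0 := fun x hx => by
    have : bV x = 0 := le_antisymm (hS x hx) (hbV0 x)
    simp [hbdef_def, this]
  have hsuper := superSolution_weighted hC0 ht hρ hB'0 (fun x => (hrow x).2.1) (fun x => (hrow x).2.2.2) hbB hbS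
  have hdd0 : ∀ y, 0 ≤ B' / (1 - ρ) * exp (-t * linkSetDist S y) := fun y => by positivity
  have hddD : ∀ y, B' / (1 - ρ) * exp (-t * linkSetDist S y) ≤ B' / (1 - ρ) := fun y => by
    refine mul_le_of_le_one_right (div_nonneg hB'0 h1ρ.le) (exp_le_one_iff.2 ?_)
    have := linkSetDist_nonneg S y
    nlinarith
  have hker : ∀ (x : ZdEdge d) (η : LGConfig d (Matrix.specialUnitaryGroup (Fin N) ℂ))
      (φ : Matrix.specialUnitaryGroup (Fin N) ℂ → ℝ) (L : ℝ), Measurable φ → (∃ M, ∀ s, |φ s| ≤ M) →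
      0 ≤ L → (∀ a a', |φ a - φ a'| ≤ L * suFrobDist a a') →
      |(∫ s, φ s ∂(siteLaw (perturbedYMS (fundamentalRep (Fin N)) (N * β) W) x η)) -
          ∫ s, φ s ∂(siteLaw (perturbedYMS (fundamentalRep (Fin N)) (N * β) (W + V)) x η)| ≤ bdef x * L :=
    fun x η φ L hφm hφb hL hφL => by
      simpa only [hbdef_def] using oneLink_source_defect_S β h hWc hWdep hV hVc hVdep hoscV x (hoscVs x) (hbV x) η φ
        L hφm hφb hL hφL
  have key := abs_integral_sub_integral_le_of_gibbs_pair_tsum hγ hγ' (by positivity : (0 : ℝ) ≤ 2 * Real.sqrt N) (fun _ _ => suFrobDist_nonneg _ _)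
    suFrobDist_le suFrobDist_self hC0 (fun x => (hrow x).1)
    (fun x ω η φ L hφm hφb hL hφL => abs_integral_siteLaw_perturbedYMS_sub_le_tsum₀ hd hN hc hv hb hP hVB
      h hWc hWdep hosc hoscs hosca hlip hlips hℓ hℓs' x ω η φ L hφm hφb hL hφL)
    hρ0 hρ (fun x => (hrow x).2.2.1) hμ' hν' hb0 hker hdd0 hddD hsuper hfm hfdep hM hδ
  refine key.trans (le_of_eq ?_)
  rw [Finset.mul_sum]
  exact Finset.sum_congr rfl fun y _ => by simp only [hB'def]; ring

end SUN

/-! ### `SU(2)`, `ℤ⁴`, uniformly on the weighted ball, hypothesis-free -/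

/-- **`SU(2)`, `ℤ⁴` — tier 2: local sources are screened AT THE WEIGHT RATE, uniformly on `MemBallZdS a Λ t`.**
`0 ≤ t`, `6|β_W| e^{a} e^{t} + e^{a/2} √(2/3) Λ < 1` ⇒ for every member `W` of the weighted infinite-range ball (bare
coupling `β_W/2`), every continuous link-summable source `V` (ANY strength) whose one-link oscillation loads `≤ B`
vanish off the finite link set `S`, every DLR `μ` of `W`, EVERY DLR `ν` of `W + V`, every Lipschitz cylinder `F`
(`Λ_F`, `K_F`): `|∫ F dμ − ∫ F dν| ≤ (√2/2) · min(B,4)/(1 − ρ) · e^{−t·d(Λ_F,S)} · #Λ_F · K_F`,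
`ρ = 6|β_W| e^{a} e^{t} + e^{a/2} √(2/3) Λ`. -/
theorem su2_localScreeningS_dim4 {βW a Λ t : ℝ} (ht : 0 ≤ t)
    (hρ : 6 * |βW| * (exp a * exp t) + exp (a / 2) * Real.sqrt (2 / 3) * Λ < 1)
    {W V : Potential (ZdEdge 4) (Matrix.specialUnitaryGroup (Fin 2) ℂ)} (hmem : MemBallZdS a Λ t W)
    {BV : Finset (ZdEdge 4) → ℝ} (hV : IsLinkSummable V BV) (hVc : ∀ X, Continuous (V X))
    (hVdep : ∀ X, DependsOn (V X) (↑X : Set (ZdEdge 4)))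
    {oscV : Finset (ZdEdge 4) → ZdEdge 4 → ℝ} (hoscV : ∀ X, Dobrushin.IsOscBound (V X) (oscV X))
    (hoscVs : ∀ e, Summable fun X : Finset (ZdEdge 4) => (if e ∈ X then oscV X e else 0))
    {bV : ZdEdge 4 → ℝ} (hbV : ∀ e, ∑' X : Finset (ZdEdge 4), (if e ∈ X then oscV X e else 0) ≤ bV e)
    {B : ℝ} (hB : ∀ e, bV e ≤ B) {S : Finset (ZdEdge 4)} (hS : ∀ e, e ∉ S → bV e ≤ 0)
    {μ ν : Measure (LGConfig 4 (Matrix.specialUnitaryGroup (Fin 2) ℂ))}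
    (hμ : μ ∈ perturbedGibbsMeasuresS (d := 4) (fundamentalRep (Fin 2)) (2 * (βW / 4)) W)
    (hν : ν ∈ perturbedGibbsMeasuresS (d := 4) (fundamentalRep (Fin 2)) (2 * (βW / 4)) (W + V))
    {F : LGConfig 4 (Matrix.specialUnitaryGroup (Fin 2) ℂ) → ℝ} {ΛF : Finset (ZdEdge 4)} {KF : ℝ≥0}
    (hF : IsLipschitzCylinder (fundamentalRep (Fin 2)) F ΛF KF) :
    |(∫ σ, F σ ∂μ) - ∫ σ, F σ ∂ν| ≤
      Real.sqrt 2 / 2 * min B 4 / (1 - (6 * |βW| * (exp a * exp t) + exp (a / 2) * Real.sqrt (2 / 3) * Λ)) *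
        exp (-t * setDistEdges ΛF S) * (ΛF.card * KF) := by
  classical
  haveI : SecondCountableTopology (Matrix (Fin 2) (Fin 2) ℂ) :=
    inferInstanceAs (SecondCountableTopology (Fin 2 → Fin 2 → ℂ))
  haveI : SecondCountableTopology (Matrix.specialUnitaryGroup (Fin 2) ℂ) :=
    Topology.IsEmbedding.subtypeVal.secondCountableTopology
  obtain ⟨BW, h⟩ := hmem.summable
  obtain ⟨osc, lip, ℓ, hosc, hlip, hoscs, hosca, hlips, hℓ, hℓs, hℓt⟩ := hmem.loads
  have hc : (0 : ℝ) ≤ 2 / 3 := by norm_num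
  have hP : ∀ B : Matrix (Fin 2) (Fin 2) ℂ, matrixOpNorm B ≤ |βW / 4| * (2 * (((4 : ℕ) : ℝ) - 1)) →
      ∀ (ψ : Matrix.specialUnitaryGroup (Fin 2) ℂ → ℝ) (M : ℝ), 0 ≤ M →
        (∀ x y, |ψ x - ψ y| ≤ M * suFrobDist x y) →
        Var[ψ; (haarProbability (Matrix.specialUnitaryGroup (Fin 2) ℂ)).tilted
          fun g => ((2 : ℕ) : ℝ) * ((g : Matrix (Fin 2) (Fin 2) ℂ) * B).trace.re] ≤ 2 / 3 * M ^ 2 :=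
    fun B hB ψ M hM hψ => oneLinkPoincareSUN_two_sharp _ B hB ψ M hM hψ
  have hVB := linVariance_of_poincare (N := 2) hP
  have hv : (0 : ℝ) ≤ 2 / 3 * ((2 : ℕ) : ℝ) ^ 2 := by norm_num
  have hsq : Real.sqrt (2 / 3 * (2 / 3 * ((2 : ℕ) : ℝ) ^ 2)) = 4 / 3 := by
    rw [show (2 / 3 * (2 / 3 * ((2 : ℕ) : ℝ) ^ 2) : ℝ) = (4 / 3) ^ 2 by norm_num, Real.sqrt_sq (by norm_num)]
  have hρeq : 6 * (((4 : ℕ) : ℝ) - 1) * |βW / 4| * (exp a * exp t * Real.sqrt (2 / 3 * (2 / 3 * ((2 : ℕ) : ℝ) ^ 2))) +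
      exp (a / 2) * Real.sqrt (2 / 3) * Λ = 6 * |βW| * (exp a * exp t) + exp (a / 2) * Real.sqrt (2 / 3) * Λ := by
    rw [hsq, abs_div, abs_of_pos (by norm_num : (0 : ℝ) < 4)]
    norm_num; ring
  have hρ' : 6 * (((4 : ℕ) : ℝ) - 1) * |βW / 4| * (exp a * exp t * Real.sqrt (2 / 3 * (2 / 3 * ((2 : ℕ) : ℝ) ^ 2))) +
      exp (a / 2) * Real.sqrt (2 / 3) * Λ < 1 := by rw [hρeq]; exact hρ
  have hμ' : μ ∈ perturbedGibbsMeasuresS (d := 4) (fundamentalRep (Fin 2)) ((2 : ℕ) * (βW / 4)) W := by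
    simpa using hμ
  have hν' : ν ∈ perturbedGibbsMeasuresS (d := 4) (fundamentalRep (Fin 2)) ((2 : ℕ) * (βW / 4)) (W + V) := by
    simpa using hν
  have hA : ∀ a b : Matrix.specialUnitaryGroup (Fin 2) ℂ,
      dist (suEntries a) (suEntries b) ≤ 1 * suFrobDist a b :=
    fun a b => by rw [one_mul]; exact dist_suEntries_le_suFrobDist a b
  have key := abs_integral_sub_integral_le_of_source_S (N := 2) (d := 4) (by norm_num) (by norm_num) hc hv le_rfl hP hVB
    h hmem.continuous hmem.dependsOn hosc hoscs hosca hlip hlips hℓ ht hℓs hℓt hρ' hV hVc hVdep hoscV hoscVs hbV hB hS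
    hμ' hν' hF.measurable hF.dependsOn hF.abs_le (hF.isLipBound zero_le_one hA)
  rw [hρeq] at key
  refine key.trans ?_
  set ρ : ℝ := 6 * |βW| * (exp a * exp t) + exp (a / 2) * Real.sqrt (2 / 3) * Λ with hρdef
  have h1ρ : 0 < 1 - ρ := sub_pos.2 hρ
  have hd4 : 0 < 4 := by norm_num
  have hbV0 : ∀ e, 0 ≤ bV e := fun e =>
    le_trans (tsum_nonneg fun X => by split_ifs; exacts [(hoscV X).nonneg e, le_rfl]) (hbV e)
  have hBmin : 0 ≤ min B 4 := le_min ((hbV0 ((0 : Fin 4 → ℤ), (0 : Fin 4))).trans (hB _)) (by norm_num)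
  have hK0 : 0 ≤ Real.sqrt ((2 : ℕ) : ℝ) / 2 * min B 4 / (1 - ρ) := by positivity
  have hmono : ∑ y ∈ ΛF, exp (-t * linkSetDist S y) * (if y ∈ ΛF then (1 : ℝ) * (KF : ℝ) else 0) ≤
      exp (-t * setDistEdges ΛF S) * (ΛF.card * KF) := by
    calc ∑ y ∈ ΛF, exp (-t * linkSetDist S y) * (if y ∈ ΛF then (1 : ℝ) * (KF : ℝ) else 0)
        ≤ ∑ y ∈ ΛF, exp (-t * setDistEdges ΛF S) * KF := Finset.sum_le_sum fun y hy => by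
          rw [if_pos hy, one_mul]
          refine mul_le_mul_of_nonneg_right (exp_le_exp.2 ?_) KF.2
          have := setDistEdges_le_linkSetDist (Λ₂ := S) hy
          nlinarith
      _ = exp (-t * setDistEdges ΛF S) * (ΛF.card * KF) := by rw [Finset.sum_const, nsmul_eq_mul]; ring
  have h2 : Real.sqrt ((2 : ℕ) : ℝ) = Real.sqrt 2 := by norm_num
  calc Real.sqrt ((2 : ℕ) : ℝ) / 2 * min B 4 / (1 - ρ) *
        ∑ y ∈ ΛF, exp (-t * linkSetDist S y) * (if y ∈ ΛF then (1 : ℝ) * (KF : ℝ) else 0)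
      ≤ Real.sqrt ((2 : ℕ) : ℝ) / 2 * min B 4 / (1 - ρ) * (exp (-t * setDistEdges ΛF S) * (ΛF.card * KF)) :=
        mul_le_mul_of_nonneg_left hmono hK0
    _ = Real.sqrt 2 / 2 * min B 4 / (1 - ρ) * exp (-t * setDistEdges ΛF S) * (ΛF.card * KF) := by
        rw [h2]; ring

end Summit.Ventures.YMGap.RobustBall

end
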